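import Summits.AtomisticToContinuum.HydrodynamicLimit.Theorems.AntiMazurCoboundariesInfluenceLocalityAnchoredCovering
import Summits.AtomisticToContinuum.HydrodynamicLimit.Theorems.AntiMazurCoboundariesInfluenceLocalityFirstMomentObjects
import HarnessLib

/-!
# Stub `stub_nearChainOfChain` of the line `slab-percolation-shadow` (crux `InfluenceLocality`,
# stmt-AtomisticToContinuum-13916): slab pigeonhole and pull-back

The registered sub-stub `NearChainOfChain` of the first-moment objects module
(`AntiMazurCoboundariesInfluenceLocalityFirstMomentObjects`), a DETERMINISTIC kinematic lemma: on
a good datum, a tight anchored chain of `K` links of absolute speed `w + ‖u₀‖` ending at `i`,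
whose halo `B(x_i(0), (R + D)ℓ)` (`D = (u + ‖u₀‖)T + 2σ`) is `u`-capped at every real time of
`[0, Tℓ]`, with the budget `(K+2)σ + (u+w+2‖u₀‖)T ≤ R`, yields for every slab number `S ≥ 1` and
every `r₀` with `S (r₀+1) ≤ K+1` a slab `s < S` such that at the slab's end time
`t_s = Tℓ(s+1)/S` a near-contact chain of `r₀` links with steps `≤ (2σ + 3(w+‖u₀‖)T/S)ℓ` starts
within `2Rℓ` of `x_i(t_s)`.

* `slabIndex_bounds`, `exists_const_block`, `exists_slab_run` — the slab pigeonhole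
  over monotone grid parameters `q 0 ≤ ⋯ ≤ q K` in `[0, 1]`: the slab index
  `min ⌊q S⌋ (S - 1)` is monotone, so among the `S` index blocks of length `r₀ + 1` one is
  constant (otherwise the index climbs to `S`);
* `disp_le_of_capped_halo` — the guarded displacement bound `disp_le_of_guarded_speed` inside a
  capped halo; `torusDist_last_le_of_chain` — distance to the head along a chain;
* `nearChain_of_run` — re-indexing a run of consecutive chain members as a `NearChain`;
* `stub_nearChainOfChain : NearChainOfChain`.
-/

namespace Summit.AtomisticToContinuum.HydrodynamicLimit.Theorems.TrueAnchoredInfection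

open Set Function
open Literature.Analysis Literature.Analysis.FluidPDE Literature.MathematicalPhysics.KineticTheory

noncomputable section

/-! ## Slab pigeonhole -/

/-- The slab index `min ⌊x S⌋ (S - 1)` of a point `x` among the `S ≥ 1` slabs `[s/S, (s+1)/S]`
is `< S`. -/
theorem slabIndex_lt {S : ℕ} (hS : 0 < S) (x : ℝ) : min ⌊x * S⌋₊ (S - 1) < S :=
  (min_le_right _ _).trans_lt (Nat.sub_lt hS Nat.one_pos)

/-- The slab index `min ⌊x S⌋ (S - 1)` is monotone in `x`. -/
theorem slabIndex_mono (S : ℕ) {x y : ℝ} (hxy : x ≤ y) :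
    min ⌊x * S⌋₊ (S - 1) ≤ min ⌊y * S⌋₊ (S - 1) :=
  min_le_min_right (S - 1) (Nat.floor_le_floor (mul_le_mul_of_nonneg_right hxy (Nat.cast_nonneg S)))

/-- A point `x ∈ [0, 1]` lies in its slab: `s/S ≤ x ≤ (s+1)/S` for `s = min ⌊x S⌋ (S - 1)`. -/
theorem slabIndex_bounds {S : ℕ} (hS : 0 < S) {x : ℝ} (hx0 : 0 ≤ x) (hx1 : x ≤ 1) :
    ((min ⌊x * S⌋₊ (S - 1) : ℕ) : ℝ) / S ≤ x ∧ x ≤ (((min ⌊x * S⌋₊ (S - 1) : ℕ) : ℝ) + 1) / S := by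
  have hSpos : (0 : ℝ) < S := by exact_mod_cast hS
  have hxS : 0 ≤ x * S := by positivity
  constructor
  · rw [div_le_iff₀ hSpos]
    calc ((min ⌊x * S⌋₊ (S - 1) : ℕ) : ℝ) ≤ ⌊x * S⌋₊ := by exact_mod_cast min_le_left _ _
      _ ≤ x * S := Nat.floor_le hxS
  · rw [le_div_iff₀ hSpos]
    rcases le_total ⌊x * S⌋₊ (S - 1) with h | h
    · rw [min_eq_left h]
      exact (Nat.lt_floor_add_one _).le
    · rw [min_eq_right h, Nat.cast_pred hS, sub_add_cancel]
      simpa using mul_le_mul_of_nonneg_right hx1 hSpos.le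

/-- Blocks of a bounded monotone sequence: among the `S` index blocks `[k(r+1), k(r+1)+r]`,
`k < S`, of a monotone `g : ℕ → ℕ` with values `< S`, one is constant (otherwise `g` climbs by
one on every block and reaches `S`). -/
theorem exists_const_block {S r : ℕ} (hS : 0 < S) (g : ℕ → ℕ) (hg : Monotone g)
    (hgS : ∀ n, g n < S) : ∃ k < S, g (k * (r + 1) + r) = g (k * (r + 1)) := by
  by_contra h
  push Not at h
  have key : ∀ k < S, k + 1 ≤ g (k * (r + 1) + r) := by
    intro k
    induction k with
    | zero =>
      intro h0
      have h1 := h 0 h0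
      have h2 : g (0 * (r + 1)) ≤ g (0 * (r + 1) + r) := hg (Nat.le_add_right _ _)
      omega
    | succ k ih =>
      intro hk
      have h1 := ih (Nat.lt_of_succ_lt hk)
      have h2 := h (k + 1) hk
      have e : (k + 1) * (r + 1) = k * (r + 1) + r + 1 := by ring
      have h3 : g (k * (r + 1) + r) ≤ g ((k + 1) * (r + 1)) := hg (by omega)
      have h4 : g ((k + 1) * (r + 1)) ≤ g ((k + 1) * (r + 1) + r) := hg (Nat.le_add_right _ _)
      omega
  have h1 := key (S - 1) (Nat.sub_lt hS Nat.one_pos)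
  have h2 := hgS ((S - 1) * (r + 1) + r)
  omega

/-- **Slab pigeonhole.** For `K + 1` monotone grid parameters `q 0 ≤ ⋯ ≤ q K` in `[0, 1]` and
`S ≥ 1` slabs with `S (r₀ + 1) ≤ K + 1`, some slab `[s/S, (s+1)/S]` contains a run
`q m₀, …, q (m₀ + r₀)` of `r₀ + 1` consecutive parameters. -/
theorem exists_slab_run {K S r₀ : ℕ} (hS : 0 < S) (hSr : S * (r₀ + 1) ≤ K + 1)
    (q : Fin (K + 1) → ℝ) (hq : Monotone q) (hq01 : ∀ m, 0 ≤ q m ∧ q m ≤ 1) :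
    ∃ s < S, ∃ m₀ : ℕ, m₀ + r₀ ≤ K ∧ ∀ m : Fin (K + 1), m₀ ≤ m.val → m.val ≤ m₀ + r₀ →
      (s : ℝ) / S ≤ q m ∧ q m ≤ ((s : ℝ) + 1) / S := by
  set g : ℕ → ℕ := fun n =>
    min ⌊q ⟨min n K, Nat.lt_succ_of_le (min_le_right _ _)⟩ * S⌋₊ (S - 1) with hg
  have hgmono : Monotone g := fun a b hab =>
    slabIndex_mono S (hq (Fin.mk_le_mk.2 (min_le_min_right K hab)))
  have hgS : ∀ n, g n < S := fun n => slabIndex_lt hS _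
  obtain ⟨k, hk, hconst⟩ := exists_const_block (r := r₀) hS g hgmono hgS
  have hm₀ : k * (r₀ + 1) + r₀ ≤ K := by
    have h1 : (k + 1) * (r₀ + 1) ≤ S * (r₀ + 1) := Nat.mul_le_mul_right _ (Nat.succ_le_of_lt hk)
    have h2 : (k + 1) * (r₀ + 1) = k * (r₀ + 1) + r₀ + 1 := by ring
    omega
  refine ⟨g (k * (r₀ + 1)), hgS _, k * (r₀ + 1), hm₀, fun m h1 h2 => ?_⟩
  have hgm : g m.val = g (k * (r₀ + 1)) := le_antisymm ((hgmono h2).trans hconst.le) (hgmono h1)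
  have hmin : (⟨min m.val K, Nat.lt_succ_of_le (min_le_right _ _)⟩ : Fin (K + 1)) = m :=
    Fin.ext (min_eq_left (Nat.lt_succ_iff.1 m.2))
  have hgm' : g m.val = min ⌊q m * S⌋₊ (S - 1) := by
    simp only [hg, hmin]
  rw [← hgm, hgm']
  exact slabIndex_bounds hS (hq01 m).1 (hq01 m).2

/-! ## Kinematic lemmas -/

section Kinematics

variable {d : Type*} [Fintype d] {ε : ℝ} {n : ℕ} {γ : ℝ → Config n d (UnitAddTorus d)}

/-- **Guarded displacement in a capped halo.** If the speed of particle `p` is `≤ V` whenever,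
during `[0, L]`, it is within `ρ'` of `x₀`, and at a time `a ≥ 0` it is so close to `x₀` that
`dist(x_p(a), x₀) + V (b - a) < ρ'` (`b ≤ L`), then on `[a, b]` it moves by at most `V (t - a)`
(`disp_le_of_guarded_speed`: under the displacement bound the particle is in the halo). -/
theorem disp_le_of_capped_halo (h : IsHardSphereTrajectory (Torus.geometry d) ε n γ) (p : Fin n)
    (x₀ : UnitAddTorus d) {L V ρ' a b : ℝ} (hV : 0 ≤ V) (ha : 0 ≤ a) (hb : b ≤ L)
    (hcap : ∀ t ∈ Icc 0 L, Torus.euclidDist (γ t p).1 x₀ < ρ' → ‖(γ t p).2‖ ≤ V)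
    (hfit : Torus.euclidDist (γ a p).1 x₀ + V * (b - a) < ρ') :
    ∀ t ∈ Icc a b, Torus.euclidDist (γ t p).1 (γ a p).1 ≤ V * (t - a) := by
  refine disp_le_of_guarded_speed h p fun t ht hdisp => hcap t ⟨ha.trans ht.1, ht.2.le.trans hb⟩ ?_
  have h1 : V * (t - a) ≤ V * (b - a) := mul_le_mul_of_nonneg_left (by linarith [ht.2]) hV
  calc Torus.euclidDist (γ t p).1 x₀
      ≤ Torus.euclidDist (γ t p).1 (γ a p).1 + Torus.euclidDist (γ a p).1 x₀ :=
        torusDist_triangle _ _ _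
    _ < ρ' := by linarith

/-- **Distance to the head along a chain.** Points `x 0, …, x K` of the torus with steps
`dist(x (m+1), x m) ≤ e + W (τ (m+1) - τ m)` satisfy
`dist(x m, x K) ≤ (K - m) e + W (τ K - τ m)` (backward induction along the chain). -/
theorem torusDist_last_le_of_chain {K : ℕ} (x : Fin (K + 1) → UnitAddTorus d)
    (τ : Fin (K + 1) → ℝ) (e W : ℝ)
    (hlink : ∀ m : Fin K, Torus.euclidDist (x m.succ) (x m.castSucc) ≤
      e + W * (τ m.succ - τ m.castSucc)) (m : Fin (K + 1)) :
    Torus.euclidDist (x m) (x (Fin.last K)) ≤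
      ((K : ℝ) - (m : ℕ)) * e + W * (τ (Fin.last K) - τ m) := by
  induction m using Fin.reverseInduction with
  | last => simp [Torus.euclidDist_self]
  | cast m ih =>
    have h1 := hlink m
    rw [Torus.euclidDist_comm] at h1
    have h2 := torusDist_triangle (x m.castSucc) (x m.succ) (x (Fin.last K))
    simp only [Fin.val_succ, Fin.val_castSucc, Nat.cast_add, Nat.cast_one] at ih ⊢
    linarith

end Kinematics

/-! ## Re-indexing a run -/

/-- Re-indexing a run: `r₀ + 1` consecutive members `j m₀, …, j (m₀ + r₀)` of an injective family,
with consecutive members `δ`-close at time `t` and the first one `ρ`-close to `i`, form a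
`NearChain`. -/
theorem nearChain_of_run {N : ℕ} {σ : ℝ} (Φ : Flow σ N) (t δ ρ : ℝ) (z : Phase N)
    (i : Fin (N + 1)) {K r₀ m₀ : ℕ} (j : Fin (K + 1) → Fin (N + 1)) (hj : Injective j)
    (hm₀ : m₀ + r₀ ≤ K)
    (hlinks : ∀ m : ℕ, m < r₀ → ∀ (hB : m₀ + m + 1 < K + 1) (hA : m₀ + m < K + 1),
      Torus.euclidDist (Φ.flow t z (j ⟨m₀ + m + 1, hB⟩)).1 (Φ.flow t z (j ⟨m₀ + m, hA⟩)).1 ≤ δ)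
    (hfirst : ∀ hA : m₀ < K + 1,
      Torus.euclidDist (Φ.flow t z (j ⟨m₀, hA⟩)).1 (Φ.flow t z i).1 ≤ ρ) :
    NearChain N Φ t r₀ δ ρ z i := by
  refine ⟨fun m => j ⟨m₀ + m, by omega⟩, fun a b hab => ?_, fun m => ?_, ?_⟩
  · have h := congrArg Fin.val (hj hab)
    exact Fin.ext (by simpa using h)
  · show Torus.euclidDist (Φ.flow t z (j ⟨m₀ + m + 1, by omega⟩)).1
      (Φ.flow t z (j ⟨m₀ + m, by omega⟩)).1 ≤ δ
    exact hlinks m m.2 _ _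
  · simpa using hfirst (by omega)

/-! ## The stub -/

/-- **Registered sub-stub `stub_nearChainOfChain`** of the line `slab-percolation-shadow`
(crux stmt-AtomisticToContinuum-13916): SLAB PIGEONHOLE AND PULL-BACK, `NearChainOfChain`.
Proof: (a) the anchor `x_i` moves by `≤ (u+‖u₀‖) t` on `[0, Tℓ]` (guarded displacement in the
capped halo); (b) every chain point `x_{j m}(Tℓ q_m)` lies within `(R − σ)ℓ` of `x_i(0)`
(triangle inequality along the chain, `K (1 + 1/(K+1)) ≤ K + 1`, and the budget); (c) slab
pigeonhole `exists_slab_run` on the monotone grid parameters; (d) every run particle is pulled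
from its grid time to the slab end `t_s` inside the capped halo, moving by `≤ (u+‖u₀‖)Tℓ/S`;
(e) consecutive run particles are then `(2σ + 3(w+‖u₀‖)T/S)ℓ`-close at `t_s` and the first one is
within `2Rℓ` of `x_i(t_s)`; (f) re-index the run (`nearChain_of_run`). -/
theorem stub_nearChainOfChain : NearChainOfChain := by
  intro σ T R u w u₀ N K S r₀ Φ z i hz hσ hT hu huw hS hSr hR hchain H
  obtain ⟨j, q, hj, hji, hqmono, hq01, hlink⟩ := hchain
  -- abbreviations: `L = Tℓ`, `ε = σℓ`, `V = u + ‖u₀‖ ≤ W = w + ‖u₀‖`, halo radius `ρ'`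
  set L : ℝ := T * ell N with hLdef
  set ε : ℝ := hsDiameter σ N with hεdef
  set V : ℝ := u + ‖u₀‖ with hVdef
  set W : ℝ := w + ‖u₀‖ with hWdef
  set ρ' : ℝ := (R + haloMargin u₀ σ T u) * ell N with hρ'def
  have hℓ : 0 < ell N := Real.rpow_pos_of_pos (by positivity) _
  have hεℓ : ε = σ * ell N := rfl
  have hσℓ : 0 < σ * ell N := mul_pos hσ hℓ
  have hε0 : 0 < ε := hεℓ ▸ hσℓ
  have hL0 : 0 < L := mul_pos hT hℓ
  have hu₀ : 0 ≤ ‖u₀‖ := norm_nonneg _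
  have hV0 : 0 < V := by rw [hVdef]; linarith
  have hVW : V ≤ W := by rw [hVdef, hWdef]; linarith
  have hW0 : 0 ≤ W := (hV0.trans_le hVW).le
  have hSpos : (0 : ℝ) < S := by exact_mod_cast hS
  have hS1 : (1 : ℝ) ≤ S := by exact_mod_cast Nat.one_le_of_lt hS
  have hKσ : 0 ≤ (K : ℝ) * σ := by positivity
  have hRVW : ((K : ℝ) + 2) * σ + (V + W) * T ≤ R := by
    have : (V + W) * T = (u + w + 2 * ‖u₀‖) * T := by rw [hVdef, hWdef]; ring
    linarith
  have hVWT : 0 ≤ (V + W) * T := by positivity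
  have hRσ : 0 ≤ R - σ := by linarith
  have hVT : 2 * V * T ≤ R := by
    have := mul_le_mul_of_nonneg_right hVW hT.le
    linarith
  have hρ' : ρ' = (R + V * T + 2 * σ) * ell N := by
    rw [hρ'def, hVdef]; unfold haloMargin; ring
  -- the margin of the halo
  have hfitA : (R - σ) * ell N + V * L < ρ' := by
    rw [hρ', hLdef]; linarith
  -- the trajectory and the cap, in absolute speed, at every real time of `[0, L]`
  have hΓ : IsHardSphereTrajectory G3 ε (N + 1) fun t => Φ.flow t z := Φ.isTrajectory z hz
  have hΓ0 : Φ.flow 0 z = z := Φ.flow_zero z hz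
  have hcap : ∀ c, ∀ t ∈ Icc 0 L, Torus.euclidDist (Φ.flow t z c).1 (z i).1 < ρ' →
      ‖(Φ.flow t z c).2‖ ≤ V := by
    intro c t ht hin
    have hle : ‖(Φ.flow t z c).2 - u₀‖ ≤ u := H c t ht hin
    calc ‖(Φ.flow t z c).2‖ = ‖(Φ.flow t z c).2 - u₀ + u₀‖ := by rw [sub_add_cancel]
      _ ≤ ‖(Φ.flow t z c).2 - u₀‖ + ‖u₀‖ := norm_add_le _ _
      _ ≤ V := by rw [hVdef]; linarith
  -- (a) the anchor `x_i` moves by at most `V t`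
  have hdisp_i : ∀ t ∈ Icc 0 L, Torus.euclidDist (Φ.flow t z i).1 (z i).1 ≤ V * t := by
    have hfit : Torus.euclidDist (Φ.flow 0 z i).1 (z i).1 + V * (L - 0) < ρ' := by
      rw [hΓ0, Torus.euclidDist_self]
      have : 0 ≤ (R - σ) * ell N := mul_nonneg hRσ hℓ.le
      linarith
    intro t ht
    have h : Torus.euclidDist (Φ.flow t z i).1 (Φ.flow 0 z i).1 ≤ V * (t - 0) :=
      disp_le_of_capped_halo hΓ i (z i).1 hV0.le le_rfl le_rfl (hcap i) hfit t ht
    rwa [hΓ0, sub_zero] at h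
  -- grid parameters as reals, and the links in real form
  set qr : Fin (K + 1) → ℝ := fun m => ((q m : ℚ) : ℝ) with hqrdef
  have hqr : Monotone qr := fun a b hab =>
    show ((q a : ℚ) : ℝ) ≤ ((q b : ℚ) : ℝ) by exact_mod_cast hqmono hab
  have hqr01 : ∀ m, 0 ≤ qr m ∧ qr m ≤ 1 := fun m => by
    constructor
    · show (0 : ℝ) ≤ ((q m : ℚ) : ℝ)
      exact_mod_cast (hq01 m).1
    · show ((q m : ℚ) : ℝ) ≤ 1
      exact_mod_cast (hq01 m).2
  have hlink' : ∀ m : Fin K, Torus.euclidDist (Φ.flow (L * qr m.succ) z (j m.succ)).1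
      (Φ.flow (L * qr m.castSucc) z (j m.castSucc)).1 ≤
      ε * (1 + 1 / ((K : ℝ) + 1)) + W * (L * qr m.succ - L * qr m.castSucc) := by
    intro m
    have h := hlink m
    rw [mul_sub] at h
    exact h
  -- (b) chain points lie within `(R - σ)ℓ` of the anchor `x_i(0)`
  have hfin : ((K : ℝ) + 1) * ε + W * L + V * L ≤ (R - σ) * ell N := by
    have key := mul_le_mul_of_nonneg_right hRVW hℓ.le
    rw [hεℓ, hLdef]
    linarith
  have hKε : (K : ℝ) * (ε * (1 + 1 / ((K : ℝ) + 1))) ≤ ((K : ℝ) + 1) * ε := by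
    have hK1 : (K : ℝ) / ((K : ℝ) + 1) ≤ 1 := (div_le_one (by positivity)).2 (by linarith)
    have e1 : (K : ℝ) * (ε * (1 + 1 / ((K : ℝ) + 1))) = K * ε + ε * ((K : ℝ) / ((K : ℝ) + 1)) := by
      ring
    rw [e1]
    have := mul_le_mul_of_nonneg_left hK1 hε0.le
    linarith
  have hε' : 0 ≤ ε * (1 + 1 / ((K : ℝ) + 1)) := by positivity
  have hnear : ∀ m : Fin (K + 1),
      Torus.euclidDist (Φ.flow (L * qr m) z (j m)).1 (z i).1 ≤ (R - σ) * ell N := by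
    intro m
    have h1 : Torus.euclidDist (Φ.flow (L * qr m) z (j m)).1
        (Φ.flow (L * qr (Fin.last K)) z (j (Fin.last K))).1 ≤
        ((K : ℝ) - (m : ℕ)) * (ε * (1 + 1 / ((K : ℝ) + 1))) +
          W * (L * qr (Fin.last K) - L * qr m) :=
      torusDist_last_le_of_chain (fun m => (Φ.flow (L * qr m) z (j m)).1) (fun m => L * qr m)
        _ W hlink' m
    rw [hji] at h1
    have ht : L * qr (Fin.last K) ∈ Icc 0 L :=
      ⟨mul_nonneg hL0.le (hqr01 _).1, mul_le_of_le_one_right hL0.le (hqr01 _).2⟩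
    have h2 := hdisp_i _ ht
    have h3 := torusDist_triangle (Φ.flow (L * qr m) z (j m)).1
      (Φ.flow (L * qr (Fin.last K)) z i).1 (z i).1
    have hme : 0 ≤ ((m : ℕ) : ℝ) * (ε * (1 + 1 / ((K : ℝ) + 1))) :=
      mul_nonneg (Nat.cast_nonneg _) hε'
    have hb2 : 0 ≤ L * qr m := mul_nonneg hL0.le (hqr01 m).1
    have hWb : W * (L * qr (Fin.last K) - L * qr m) ≤ W * L :=
      mul_le_mul_of_nonneg_left (by linarith [ht.2]) hW0
    have hVb : V * (L * qr (Fin.last K)) ≤ V * L := mul_le_mul_of_nonneg_left ht.2 hV0.le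
    linarith
  -- (c) slab pigeonhole
  obtain ⟨s, hs, m₀, hm₀, hrun⟩ := exists_slab_run hS hSr qr hqr hqr01
  refine ⟨s, hs, ?_⟩
  -- the slab end time
  set tstar : ℝ := L * ((s : ℝ) + 1) / S with htdef
  have hsS : (s : ℝ) + 1 ≤ S := by exact_mod_cast Nat.lt_iff_add_one_le.1 hs
  have hts1 : tstar ≤ L := by
    rw [htdef, div_le_iff₀ hSpos]
    exact mul_le_mul_of_nonneg_left hsS hL0.le
  have hts0 : 0 ≤ tstar := by positivity
  have hLS : L / S ≤ L := div_le_self hL0.le hS1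
  -- (d) run members: grid time `≤ tstar ≤` grid time `+ L/S`; pulled displacement `≤ V L / S`
  have hpull : ∀ m : Fin (K + 1), m₀ ≤ m.val → m.val ≤ m₀ + r₀ →
      L * qr m ≤ tstar ∧ tstar - L * qr m ≤ L / S ∧
      Torus.euclidDist (Φ.flow tstar z (j m)).1 (Φ.flow (L * qr m) z (j m)).1 ≤ V * (L / S) := by
    intro m h1 h2
    obtain ⟨hq1, hq2⟩ := hrun m h1 h2
    have ha1 : L * qr m ≤ tstar := by
      rw [htdef, mul_div_assoc]
      exact mul_le_mul_of_nonneg_left hq2 hL0.le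
    have ha2 : tstar - L * qr m ≤ L / S := by
      have e : tstar - L / S = L * ((s : ℝ) / S) := by rw [htdef]; ring
      linarith [mul_le_mul_of_nonneg_left hq1 hL0.le]
    refine ⟨ha1, ha2, ?_⟩
    have ha0 : 0 ≤ L * qr m := mul_nonneg hL0.le (hqr01 m).1
    have hfit : Torus.euclidDist (Φ.flow (L * qr m) z (j m)).1 (z i).1 +
        V * (tstar - L * qr m) < ρ' := by
      have hn := hnear m
      have : V * (tstar - L * qr m) ≤ V * L := mul_le_mul_of_nonneg_left (ha2.trans hLS) hV0.le
      linarith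
    have h : Torus.euclidDist (Φ.flow tstar z (j m)).1 (Φ.flow (L * qr m) z (j m)).1 ≤
        V * (tstar - L * qr m) :=
      disp_le_of_capped_halo hΓ (j m) (z i).1 hV0.le ha0 hts1 (hcap (j m)) hfit tstar ⟨ha1, le_rfl⟩
    exact h.trans (mul_le_mul_of_nonneg_left ha2 hV0.le)
  -- (e) the arithmetic of the two bounds
  have hδ : V * (L / S) + (ε * (1 + 1 / ((K : ℝ) + 1)) + W * (L / S)) + V * (L / S) ≤
      (2 * σ + 3 * W * T / S) * ell N := by
    have hK1 : 1 / ((K : ℝ) + 1) ≤ 1 :=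
      (div_le_one (by positivity)).2 (by linarith [(Nat.cast_nonneg K : (0 : ℝ) ≤ K)])
    have h1 := mul_le_mul_of_nonneg_left hK1 hε0.le
    have h2 : V * (L / S) ≤ W * (L / S) := mul_le_mul_of_nonneg_right hVW (by positivity)
    have h3 : (2 * σ + 3 * W * T / S) * ell N = 2 * ε + 3 * (W * (L / S)) := by
      rw [hεℓ, hLdef]; ring
    linarith
  have h2R : V * (L / S) + (R - σ) * ell N + V * tstar ≤ 2 * R * ell N := by
    have h1 : V * (L / S) ≤ V * L := mul_le_mul_of_nonneg_left hLS hV0.le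
    have h2 : V * tstar ≤ V * L := mul_le_mul_of_nonneg_left hts1 hV0.le
    have h3 : 2 * (V * L) + (R - σ) * ell N ≤ 2 * R * ell N := by
      have := mul_le_mul_of_nonneg_right hVT hℓ.le
      rw [hLdef]; linarith
    linarith
  -- (f) the near-contact chain at time `tstar`
  apply nearChain_of_run Φ tstar _ _ z i j hj hm₀
  · intro m hm hB hA
    have hmK : m₀ + m < K := by omega
    have hl := hlink' ⟨m₀ + m, hmK⟩
    simp only [Fin.succ_mk, Fin.castSucc_mk] at hl
    obtain ⟨-, -, hpA⟩ := hpull ⟨m₀ + m, hA⟩ (Nat.le_add_right _ _)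
      (show m₀ + m ≤ m₀ + r₀ by omega)
    obtain ⟨-, -, hpB⟩ := hpull ⟨m₀ + m + 1, hB⟩ (show m₀ ≤ m₀ + m + 1 by omega)
      (show m₀ + m + 1 ≤ m₀ + r₀ by omega)
    obtain ⟨hqA1, -⟩ := hrun ⟨m₀ + m, hA⟩ (Nat.le_add_right _ _) (show m₀ + m ≤ m₀ + r₀ by omega)
    obtain ⟨-, hqB2⟩ := hrun ⟨m₀ + m + 1, hB⟩ (show m₀ ≤ m₀ + m + 1 by omega)
      (show m₀ + m + 1 ≤ m₀ + r₀ by omega)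
    have e : L / S = L * (((s : ℝ) + 1) / S) - L * ((s : ℝ) / S) := by ring
    have hqq : L * qr ⟨m₀ + m + 1, hB⟩ - L * qr ⟨m₀ + m, hA⟩ ≤ L / S := by
      linarith [mul_le_mul_of_nonneg_left hqB2 hL0.le, mul_le_mul_of_nonneg_left hqA1 hL0.le]
    have hWq : W * (L * qr ⟨m₀ + m + 1, hB⟩ - L * qr ⟨m₀ + m, hA⟩) ≤ W * (L / S) :=
      mul_le_mul_of_nonneg_left hqq hW0
    have htri1 := torusDist_triangle (Φ.flow tstar z (j ⟨m₀ + m + 1, hB⟩)).1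
      (Φ.flow (L * qr ⟨m₀ + m + 1, hB⟩) z (j ⟨m₀ + m + 1, hB⟩)).1
      (Φ.flow tstar z (j ⟨m₀ + m, hA⟩)).1
    have htri2 := torusDist_triangle (Φ.flow (L * qr ⟨m₀ + m + 1, hB⟩) z (j ⟨m₀ + m + 1, hB⟩)).1
      (Φ.flow (L * qr ⟨m₀ + m, hA⟩) z (j ⟨m₀ + m, hA⟩)).1
      (Φ.flow tstar z (j ⟨m₀ + m, hA⟩)).1
    rw [Torus.euclidDist_comm] at hpA
    linarith
  · intro hA
    obtain ⟨-, -, hpA⟩ := hpull ⟨m₀, hA⟩ le_rfl (Nat.le_add_right _ _)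
    have hn := hnear ⟨m₀, hA⟩
    have hi := hdisp_i tstar ⟨hts0, hts1⟩
    rw [Torus.euclidDist_comm] at hi
    have htri1 := torusDist_triangle (Φ.flow tstar z (j ⟨m₀, hA⟩)).1
      (Φ.flow (L * qr ⟨m₀, hA⟩) z (j ⟨m₀, hA⟩)).1 (Φ.flow tstar z i).1
    have htri2 := torusDist_triangle (Φ.flow (L * qr ⟨m₀, hA⟩) z (j ⟨m₀, hA⟩)).1
      (z i).1 (Φ.flow tstar z i).1
    linarith

end

end Summit.AtomisticToContinuum.HydrodynamicLimit.Theorems.TrueAnchoredInfection
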